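import Literature.Computability.AlgebraicComplexity.ST21ConstantDepthOrbitHittingSetProofs
import Literature.Computability.AlgebraicComplexity.HomogeneousComponentsComplexity
import HarnessLib

/-!
# Saha–Thankey 2021, Thm 9 DISCHARGED (`sahaThankey2021_thm_9_holds`): degree truncation makes the
# `b`-variate bound a circuit-complexity statement

Topic `Literature/Computability/AlgebraicComplexity` (cell `val-lit`, row X3-ST21). Theorem-only
file (no definitions, no named facts). C. Saha, B. Thankey, *Hitting sets for orbits of circuit
classes and polynomial families*, APPROX/RANDOM 2021, LIPIcs 207:50 [SahaThankey2021], **Thm 9**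
(p. 50:5 L9–16), typed as `sahaThankey2021_thm_9` (`ST21OrbitHittingSets.lean`; EXISTENCE reading:
"a hitting set of size `≤ T` exists", explicitness dropped): for `C` = the `n`-variate degree-`D`
polynomials computed by depth-`Δ` occur-`k` formulas of size `s`, `R = (2k)^{2Δ·2^Δ}`, and
`char F = 0` or `> (2ks)^{Δ³R}`: (first bound) a hitting set for `orb(C)` of size
`(nRD)^{O(R(log R + Δ log k + Δ log s) + ΔR)}`; (second bound) if the leaves are `b`-variate, one of
size `(nRD)^{O(Rb + ΔR)}` — a bound WITHOUT `s`.

The first bound is `SahaThankey2021.thm_9_general_bound` (`ST21ConstantDepthOrbitHittingSetProofs.lean`,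
Heintz–Schnorr existence on `L(f) ≤ 2s + …`). This file proves the SECOND bound
(`SahaThankey2021.thm_9_bVariate_bound`, `c = 150`) and closes the fact by the edge
`SahaThankey2021.sahaThankey2021_thm_9_of_bVariate_bound`:

  `sahaThankey2021_thm_9_holds : sahaThankey2021_thm_9`.

## The argument (route ≠ the printed explicit construction — disclosed)

The obstacle for an `s`-free bound is that the class bounds leaf degrees, `×⋏` exponents and fan-ins
only through `size ≤ s`, and occur-`k` formulas (`k ≥ 2`) may cancel high-degree intermediate
results. It disappears under DEGREE TRUNCATION `T_D f = Σ_{e ≤ D} f^{(e)}` (written out as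
`∑ e ∈ Finset.range (D+1), homogeneousComponent e f`; no definition is introduced):

* `Trunc.trunc_mul` — `T_D(fg) = T_D(T_D f · T_D g)`; with linearity and idempotence, every node of
  a formula may be truncated (`trunc_prod`, `trunc_pow`), and `f = T_D(φ.eval)` when `deg f ≤ D`.
* `Trunc.trunc_pow_eq_trunc_taylor` — `T_D(w^e) = T_D(Σ_{j ≤ D} binom(e,j) c^{e−j} (w − c)^j)`,
  `c = w(0)` (binomial expansion; `(w − c)^j` has only monomials of degree `≥ j`): the exponent `e`
  enters only through `D + 1` scalars, and `Σ_{j ≤ D} a_j v^j` costs `L(v) + (D+1)(D+2)` with the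
  substitution done once (`complexity_aeval_le`) — `complexity_sum_C_mul_pow_le`.
* `Trunc.card_support_trunc_le` — a truncated `b`-variate leaf has `≤ (D+1)^b` monomials, so
  `L ≤ 2(D+1)^{b+1}` (`complexity_le_card_support_mul`).
* `complexity_trunc_eval_le` — the semantic induction over the formula (any size, any occurrence
  pattern): `L(T_D(φ.eval)) ≤ (Σ_i occur_i(φ) + 1) · (16(D+2)^{b+4})^{depth φ}`. At a gate the
  children in which no variable occurs are constants (`Thm9.totalDegree_eval_eq_zero_of_isOccur_zero`)
  and fold into one scalar; the others number `≤ Σ_i occur_i`; each truncation costs a factor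
  `(D+2)²` (`complexity_sum_homogeneousComponent_le`, BCS Lemma (21.25)); the depth (`≤ Δ`) bounds
  the number of compounding levels, and the budget's `ΔR` term absorbs `(D+2)^{O((b+1)Δ)}`.
* Assembly (`Thm9.exists_hittingSet_main_bVariate`, `Thm9.size_bound_bVariate`): for `f ∈ C`,
  `deg f ≤ d' = min(D, s^Δ)` and `Σ_i occur_i ≤ nk`, so `L(f(Ax)) ≤ (nk+1)(16(d'+2)^{b+4})^Δ + n(2n+1)`;
  the tree's Heintz–Schnorr existence theorem `HittingSets.exists_hittingSet` (any field) on a grid of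
  `2d'+1` elements (available from the characteristic hypothesis exactly as for the first bound:
  `char F = 0` ⇒ `F` infinite; `char F = p > (2ks)^{Δ³R} ≥ 2s^Δ`) gives
  `#H ≤ y^{26(b+5)Δ + 149} + 1 ≤ y^{150(Rb + ΔR + 1)} + 150`, `y = nRD` (`R ≥ 16`, `R ≥ Δ`, `R ≥ k`).
  Degenerate rows (`n = 0`, `D = 0`, `k = 0`, `Δ ≤ 1`, `s = 0`) are classes of constants, hit by the
  point `0` (`Thm9.isHittingSetFor_zero_orb_of_totalDegree_eq_zero`).

The characteristic hypothesis is used only for the field size; the printed proof (explicit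
construction via the algebraic-independence technique for bounded-occur bounded-depth formulas) is
not reproduced. HONEST FRAMING: an existence statement about hitting sets for a 2021 circuit class,
obtained from truncation bookkeeping and 1980 counting; `VP ≠ VNP` is NOT proved and nothing here
bears on it.

## References

* [SahaThankey2021] C. Saha, B. Thankey, APPROX/RANDOM 2021, LIPIcs 207:50, Thm 9 (p. 50:5 L9–16),
  Def. 3 (p. 50:3).
* [HeintzSchnorr1980] J. Heintz, C.-P. Schnorr, *Testing polynomials which are easy to compute*,
  STOC 1980, Thm. 4.4.
* [BurgisserClausenShokrollahi1997] P. Bürgisser, M. Clausen, M. A. Shokrollahi, *Algebraic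
  Complexity Theory*, Lemma (21.25) (homogeneous components).
-/

noncomputable section

open MvPolynomial
open scoped Pointwise

namespace Literature.Computability.AlgebraicComplexity

namespace SahaThankey2021

/-! ### Degree truncation `T_D f = Σ_{e ≤ D} f^{(e)}` (written out; no definition is introduced) -/

namespace Trunc

variable {R : Type*} [CommSemiring R] {σ : Type*}

/-- Coefficients of the truncation: those of `f` in degree `≤ D`, zero above. [cite: BurgisserClausenShokrollahi1997, Lemma (21.25) and proof (homogeneous parts of degree ≤ d; those of a product depend only on those of the factors)] -/
theorem coeff_trunc (D : ℕ) (f : MvPolynomial σ R) (m : σ →₀ ℕ) :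
    coeff m (∑ e ∈ Finset.range (D + 1), homogeneousComponent e f) =
      if m.degree ≤ D then coeff m f else 0 := by
  classical
  rw [coeff_sum]
  simp_rw [coeff_homogeneousComponent]
  rw [Finset.sum_ite_eq]
  simp only [Finset.mem_range, Nat.lt_succ_iff]

/-- A polynomial of degree `≤ D` is its own truncation. [cite: BurgisserClausenShokrollahi1997, Lemma (21.25) and proof (homogeneous parts of degree ≤ d; those of a product depend only on those of the factors)] -/
theorem trunc_eq_self_of_le {D : ℕ} {f : MvPolynomial σ R} (h : f.totalDegree ≤ D) :
    ∑ e ∈ Finset.range (D + 1), homogeneousComponent e f = f := by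
  classical
  ext m
  rw [coeff_trunc]
  split_ifs with hm
  · rfl
  · symm
    by_contra hne
    exact hm ((le_totalDegree (mem_support_iff.mpr hne)).trans h)

/-- The truncation has degree `≤ D`. [cite: BurgisserClausenShokrollahi1997, Lemma (21.25) and proof (homogeneous parts of degree ≤ d; those of a product depend only on those of the factors)] -/
theorem totalDegree_trunc_le (D : ℕ) (f : MvPolynomial σ R) :
    (∑ e ∈ Finset.range (D + 1), homogeneousComponent e f).totalDegree ≤ D :=
  (totalDegree_finsetSum _ _).trans (Finset.sup_le fun e he =>
    ((homogeneousComponent_isHomogeneous e f).totalDegree_le).trans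
      (by have := Finset.mem_range.mp he; omega))

/-- Truncation is idempotent. [cite: BurgisserClausenShokrollahi1997, Lemma (21.25) and proof (homogeneous parts of degree ≤ d; those of a product depend only on those of the factors)] -/
theorem trunc_trunc (D : ℕ) (f : MvPolynomial σ R) :
    ∑ e ∈ Finset.range (D + 1), homogeneousComponent e
        (∑ e ∈ Finset.range (D + 1), homogeneousComponent e f) =
      ∑ e ∈ Finset.range (D + 1), homogeneousComponent e f :=
  trunc_eq_self_of_le (totalDegree_trunc_le D f)

/-- Truncation is additive. [cite: BurgisserClausenShokrollahi1997, Lemma (21.25) and proof (homogeneous parts of degree ≤ d; those of a product depend only on those of the factors)] -/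
theorem trunc_add (D : ℕ) (f g : MvPolynomial σ R) :
    ∑ e ∈ Finset.range (D + 1), homogeneousComponent e (f + g) =
      ∑ e ∈ Finset.range (D + 1), homogeneousComponent e f +
        ∑ e ∈ Finset.range (D + 1), homogeneousComponent e g := by
  simp only [map_add, Finset.sum_add_distrib]

/-- Truncation of a finite sum. [cite: BurgisserClausenShokrollahi1997, Lemma (21.25) and proof (homogeneous parts of degree ≤ d; those of a product depend only on those of the factors)] -/
theorem trunc_sum (D : ℕ) {ι : Type*} (s : Finset ι) (f : ι → MvPolynomial σ R) :
    ∑ e ∈ Finset.range (D + 1), homogeneousComponent e (∑ i ∈ s, f i) =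
      ∑ i ∈ s, ∑ e ∈ Finset.range (D + 1), homogeneousComponent e (f i) := by
  simp only [map_sum]
  exact Finset.sum_comm

/-- Truncation commutes with scalars. [cite: BurgisserClausenShokrollahi1997, Lemma (21.25) and proof (homogeneous parts of degree ≤ d; those of a product depend only on those of the factors)] -/
theorem trunc_smul (D : ℕ) (a : R) (f : MvPolynomial σ R) :
    ∑ e ∈ Finset.range (D + 1), homogeneousComponent e (a • f) =
      a • ∑ e ∈ Finset.range (D + 1), homogeneousComponent e f := by
  simp only [map_smul, Finset.smul_sum]

/-- Truncation commutes with constant factors. [cite: BurgisserClausenShokrollahi1997, Lemma (21.25) and proof (homogeneous parts of degree ≤ d; those of a product depend only on those of the factors)] -/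
theorem trunc_C_mul (D : ℕ) (a : R) (f : MvPolynomial σ R) :
    ∑ e ∈ Finset.range (D + 1), homogeneousComponent e (C a * f) =
      C a * ∑ e ∈ Finset.range (D + 1), homogeneousComponent e f := by
  rw [← smul_eq_C_mul, ← smul_eq_C_mul, trunc_smul]

/-- Constants are their own truncation. [cite: BurgisserClausenShokrollahi1997, Lemma (21.25) and proof (homogeneous parts of degree ≤ d; those of a product depend only on those of the factors)] -/
theorem trunc_C (D : ℕ) (a : R) :
    ∑ e ∈ Finset.range (D + 1), homogeneousComponent e (C a : MvPolynomial σ R) = C a :=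
  trunc_eq_self_of_le (by rw [totalDegree_C]; exact Nat.zero_le _)

/-- **Truncation of a product only sees the truncations of the factors**: `T(fg) = T(Tf · Tg)`
(monomials of degree `> D` in a factor only produce monomials of degree `> D`). [cite: BurgisserClausenShokrollahi1997, Lemma (21.25) and proof (homogeneous parts of degree ≤ d; those of a product depend only on those of the factors)] -/
theorem trunc_mul (D : ℕ) (f g : MvPolynomial σ R) :
    ∑ e ∈ Finset.range (D + 1), homogeneousComponent e (f * g) =
      ∑ e ∈ Finset.range (D + 1), homogeneousComponent e
        ((∑ e ∈ Finset.range (D + 1), homogeneousComponent e f) *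
          ∑ e ∈ Finset.range (D + 1), homogeneousComponent e g) := by
  classical
  ext m
  rw [coeff_trunc, coeff_trunc]
  split_ifs with hm
  · rw [coeff_mul, coeff_mul]
    refine Finset.sum_congr rfl fun x hx => ?_
    have hx' : x.1 + x.2 = m := Finset.HasAntidiagonal.mem_antidiagonal.mp hx
    have hdeg : x.1.degree + x.2.degree = m.degree := by rw [← map_add, hx']
    rw [coeff_trunc, coeff_trunc, if_pos (by omega), if_pos (by omega)]
  · rfl

/-- Truncation of a finite product only sees the truncations of the factors. [cite: BurgisserClausenShokrollahi1997, Lemma (21.25) and proof (homogeneous parts of degree ≤ d; those of a product depend only on those of the factors)] -/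
theorem trunc_prod (D : ℕ) {ι : Type*} (s : Finset ι) (h : ι → MvPolynomial σ R) :
    ∑ e ∈ Finset.range (D + 1), homogeneousComponent e (∏ i ∈ s, h i) =
      ∑ e ∈ Finset.range (D + 1), homogeneousComponent e
        (∏ i ∈ s, ∑ e ∈ Finset.range (D + 1), homogeneousComponent e (h i)) := by
  classical
  induction s using Finset.induction_on with
  | empty => simp
  | insert a s ha ih =>
      rw [Finset.prod_insert ha, Finset.prod_insert ha, trunc_mul D (h a), ih]
      conv_rhs => rw [trunc_mul, trunc_trunc]

/-- Truncation of a power only sees the truncation of the base. [cite: BurgisserClausenShokrollahi1997, Lemma (21.25) and proof (homogeneous parts of degree ≤ d; those of a product depend only on those of the factors)] -/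
theorem trunc_pow (D : ℕ) (f : MvPolynomial σ R) (e : ℕ) :
    ∑ i ∈ Finset.range (D + 1), homogeneousComponent i (f ^ e) =
      ∑ i ∈ Finset.range (D + 1), homogeneousComponent i
        ((∑ i ∈ Finset.range (D + 1), homogeneousComponent i f) ^ e) := by
  have := trunc_prod D (Finset.range e) (fun _ => f)
  simpa only [Finset.prod_const, Finset.card_range] using this

/-- Lower bounds on the degrees of monomials multiply up. [cite: BurgisserClausenShokrollahi1997, Lemma (21.25) and proof (homogeneous parts of degree ≤ d; those of a product depend only on those of the factors)] -/
theorem le_degree_of_mem_support_mul {a b : ℕ} {f g : MvPolynomial σ R}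
    (hf : ∀ m ∈ f.support, a ≤ m.degree) (hg : ∀ m ∈ g.support, b ≤ m.degree) :
    ∀ m ∈ (f * g).support, a + b ≤ m.degree := by
  classical
  intro m hm
  obtain ⟨x, hx, y, hy, rfl⟩ := Finset.mem_add.mp (support_mul f g hm)
  rw [map_add]
  exact Nat.add_le_add (hf x hx) (hg y hy)

/-- A polynomial without constant term: its `j`-th power has only monomials of degree `≥ j`.
[cite: BurgisserClausenShokrollahi1997, Lemma (21.25) and proof (homogeneous parts of degree ≤ d; those of a product depend only on those of the factors)] -/
theorem le_degree_of_mem_support_pow {f : MvPolynomial σ R} (hf : ∀ m ∈ f.support, 1 ≤ m.degree) :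
    ∀ j : ℕ, ∀ m ∈ (f ^ j).support, j ≤ m.degree
  | 0 => fun _ _ => Nat.zero_le _
  | j + 1 => by
      rw [pow_succ]
      intro m hm
      have := le_degree_of_mem_support_mul (le_degree_of_mem_support_pow hf j) hf m hm
      omega

/-- A polynomial all of whose monomials have degree `> D` truncates to `0`. [cite: BurgisserClausenShokrollahi1997, Lemma (21.25) and proof (homogeneous parts of degree ≤ d; those of a product depend only on those of the factors)] -/
theorem trunc_eq_zero_of_lt_degree {D : ℕ} {f : MvPolynomial σ R}
    (hf : ∀ m ∈ f.support, D < m.degree) :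
    ∑ e ∈ Finset.range (D + 1), homogeneousComponent e f = 0 := by
  classical
  ext m
  rw [coeff_trunc, coeff_zero]
  split_ifs with hm
  · by_contra hne
    exact absurd (hf m (mem_support_iff.mpr hne)) (by omega)
  · rfl

/-- The support of a truncation: at most `(D+1)^{#vars}` monomials (exponents `≤ D` on the
variables of `p`, zero elsewhere). [cite: BurgisserClausenShokrollahi1997, Lemma (21.25) and proof (homogeneous parts of degree ≤ d; those of a product depend only on those of the factors)] -/
theorem card_support_trunc_le (D : ℕ) (p : MvPolynomial σ R) :
    (∑ e ∈ Finset.range (D + 1), homogeneousComponent e p).support.card ≤ (D + 1) ^ p.vars.card := by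
  classical
  set T := ∑ e ∈ Finset.range (D + 1), homogeneousComponent e p with hT
  have hsub : ∀ m ∈ T.support, m ∈ p.support ∧ m.degree ≤ D := by
    intro m hm
    rw [mem_support_iff, hT, coeff_trunc] at hm
    split_ifs at hm with h
    · exact ⟨mem_support_iff.mpr hm, h⟩
    · exact absurd rfl hm
  have hle : ∀ m ∈ T.support, ∀ v, m v ≤ D := by
    intro m hm v
    refine le_trans ?_ (hsub m hm).2
    by_cases hv : v ∈ m.support
    · exact Finset.single_le_sum (f := fun w => m w) (fun _ _ => Nat.zero_le _) hv
    · rw [Finsupp.notMem_support_iff.mp hv]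
      exact Nat.zero_le _
  have hzero : ∀ m ∈ T.support, ∀ v, v ∉ p.vars → m v = 0 := by
    intro m hm v hv
    by_contra h
    exact hv ((mem_vars_iff_mem_support v).mpr ⟨m, (hsub m hm).1, Finsupp.mem_support_iff.mpr h⟩)
  let ι : (σ →₀ ℕ) → (p.vars → Fin (D + 1)) := fun m v => ⟨min (m v) D, by omega⟩
  calc T.support.card ≤ (Finset.univ : Finset (p.vars → Fin (D + 1))).card :=
        Finset.card_le_card_of_injOn ι (fun _ _ => Finset.mem_univ _) (by
          intro m hm m' hm' h
          ext v
          by_cases hv : v ∈ p.vars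
          · have h1 := congr_fun h ⟨v, hv⟩
            simp only [ι, Fin.mk.injEq] at h1
            rwa [min_eq_left (hle m hm v), min_eq_left (hle m' hm' v)] at h1
          · rw [hzero m hm v hv, hzero m' hm' v hv])
    _ = (D + 1) ^ p.vars.card := by
        rw [Finset.card_univ, Fintype.card_fun, Fintype.card_fin, Fintype.card_coe]

end Trunc

/-! ### Truncated powers: the binomial Taylor form (exponent-free cost) -/

namespace Trunc

variable {K : Type*} [CommRing K] {σ : Type*}

/-- `w − w(0)` has no constant term. [cite: BurgisserClausenShokrollahi1997, Lemma (21.25) and proof (homogeneous parts of degree ≤ d; those of a product depend only on those of the factors)] -/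
theorem one_le_degree_of_mem_support_sub_C (w : MvPolynomial σ K) :
    ∀ m ∈ (w - C (coeff 0 w)).support, 1 ≤ m.degree := by
  classical
  intro m hm
  rw [Nat.one_le_iff_ne_zero, Ne, Finsupp.degree_eq_zero_iff]
  rintro rfl
  rw [mem_support_iff, coeff_sub, coeff_zero_C, sub_self] at hm
  exact hm rfl

/-- **Truncated powers, binomial Taylor form**: with `c = w(0)`,
`T_D(w^e) = T_D(Σ_{j ≤ D} binom(e,j) c^{e−j} (w − c)^j)` — the exponent `e` enters only through
`D + 1` scalars. [cite: BurgisserClausenShokrollahi1997, Lemma (21.25) and proof (homogeneous parts of degree ≤ d; those of a product depend only on those of the factors)] -/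
theorem trunc_pow_eq_trunc_taylor (D : ℕ) (w : MvPolynomial σ K) (e : ℕ) :
    ∑ i ∈ Finset.range (D + 1), homogeneousComponent i (w ^ e) =
      ∑ i ∈ Finset.range (D + 1), homogeneousComponent i
        (∑ j ∈ Finset.range (D + 1),
          C ((e.choose j : K) * coeff 0 w ^ (e - j)) * (w - C (coeff 0 w)) ^ j) := by
  classical
  -- the general term after truncation
  have hw : w = (w - C (coeff 0 w)) + C (coeff 0 w) := (sub_add_cancel _ _).symm
  have hterm : ∀ j : ℕ, (w - C (coeff 0 w)) ^ j * C (coeff 0 w) ^ (e - j) *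
      (e.choose j : MvPolynomial σ K) =
      C ((e.choose j : K) * coeff 0 w ^ (e - j)) * (w - C (coeff 0 w)) ^ j := by
    intro j
    rw [map_mul, map_natCast, C_pow]
    ring
  have hL : ∑ i ∈ Finset.range (D + 1), homogeneousComponent i (w ^ e) =
      ∑ j ∈ Finset.range (e + 1), C ((e.choose j : K) * coeff 0 w ^ (e - j)) *
        ∑ i ∈ Finset.range (D + 1), homogeneousComponent i ((w - C (coeff 0 w)) ^ j) := by
    conv_lhs => rw [hw, add_pow]
    rw [trunc_sum]
    refine Finset.sum_congr rfl fun j _ => ?_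
    rw [← trunc_C_mul, hterm]
  have hR : ∑ i ∈ Finset.range (D + 1), homogeneousComponent i
        (∑ j ∈ Finset.range (D + 1),
          C ((e.choose j : K) * coeff 0 w ^ (e - j)) * (w - C (coeff 0 w)) ^ j) =
      ∑ j ∈ Finset.range (D + 1), C ((e.choose j : K) * coeff 0 w ^ (e - j)) *
        ∑ i ∈ Finset.range (D + 1), homogeneousComponent i ((w - C (coeff 0 w)) ^ j) := by
    rw [trunc_sum]
    exact Finset.sum_congr rfl fun j _ => trunc_C_mul _ _ _
  rw [hL, hR]
  -- both sums reduce to `j ≤ min e D`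
  have hvanL : ∀ j ∈ Finset.range (e + 1), j ∉ Finset.range (min e D + 1) →
      C ((e.choose j : K) * coeff 0 w ^ (e - j)) *
        ∑ i ∈ Finset.range (D + 1), homogeneousComponent i ((w - C (coeff 0 w)) ^ j) = 0 := by
    intro j hj hj'
    simp only [Finset.mem_range] at hj hj'
    have hjD : D < j := by
      by_contra hcon
      exact hj' (Nat.lt_succ_of_le (le_min (by omega) (by omega)))
    rw [trunc_eq_zero_of_lt_degree (fun m hm => lt_of_lt_of_le hjD
      (le_degree_of_mem_support_pow (one_le_degree_of_mem_support_sub_C w) j m hm)), mul_zero]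
  have hvanR : ∀ j ∈ Finset.range (D + 1), j ∉ Finset.range (min e D + 1) →
      C ((e.choose j : K) * coeff 0 w ^ (e - j)) *
        ∑ i ∈ Finset.range (D + 1), homogeneousComponent i ((w - C (coeff 0 w)) ^ j) = 0 := by
    intro j hj hj'
    simp only [Finset.mem_range] at hj hj'
    have hje : e < j := by
      by_contra hcon
      exact hj' (Nat.lt_succ_of_le (le_min (by omega) (by omega)))
    rw [Nat.choose_eq_zero_of_lt hje, Nat.cast_zero, zero_mul, C_0, zero_mul]
  have hsub1 : Finset.range (min e D + 1) ⊆ Finset.range (e + 1) :=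
    Finset.range_mono (Nat.succ_le_succ (min_le_left e D))
  have hsub2 : Finset.range (min e D + 1) ⊆ Finset.range (D + 1) :=
    Finset.range_mono (Nat.succ_le_succ (min_le_right e D))
  rw [← Finset.sum_subset hsub1 hvanL, ← Finset.sum_subset hsub2 hvanR]

end Trunc

/-! ### Complexity of truncations of leaves and of truncated univariate compositions -/

section Costs

variable {F : Type*} [Field F] {σ : Type*}

/-- A `b`-variate leaf truncated to degree `≤ D` costs `≤ 2(D+1)^{b+1}` (at most `(D+1)^b`
monomials of degree `≤ D`). [cite: SahaThankey2021, Thm 9 (p. 50:5), "leaves labelled by b-variate polynomials"] -/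
theorem complexity_trunc_le_of_card_vars_le (D b : ℕ) (p : MvPolynomial σ F) (hp : p.vars.card ≤ b) :
    complexity (∑ e ∈ Finset.range (D + 1), homogeneousComponent e p) ≤ 2 * (D + 1) ^ (b + 1) := by
  calc complexity (∑ e ∈ Finset.range (D + 1), homogeneousComponent e p)
      ≤ (∑ e ∈ Finset.range (D + 1), homogeneousComponent e p).support.card *
          (2 * (∑ e ∈ Finset.range (D + 1), homogeneousComponent e p).totalDegree + 2) :=
        complexity_le_card_support_mul _
    _ ≤ (D + 1) ^ b * (2 * D + 2) :=
        Nat.mul_le_mul ((Trunc.card_support_trunc_le D p).trans (Nat.pow_le_pow_right (by omega) hp))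
          (by have := Trunc.totalDegree_trunc_le D p; omega)
    _ = 2 * (D + 1) ^ (b + 1) := by ring

/-- `Σ_{j ≤ D} a_j v^j` costs `≤ L(v) + (D+1)(D+2)`: the univariate `Σ a_j t^j` with `t ← v`
substituted ONCE (`complexity_aeval_le`). [cite: Burgisser2000, Rem. 2.7 (substitution into a computation); BurgisserClausenShokrollahi1997, §21.1] -/
theorem complexity_sum_C_mul_pow_le {τ : Type*} (D : ℕ) (a : ℕ → F) (v : MvPolynomial τ F) :
    complexity (∑ j ∈ Finset.range (D + 1), C (a j) * v ^ j) ≤ complexity v + (D + 1) * (D + 2) := by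
  classical
  set Q : MvPolynomial Unit F := ∑ j ∈ Finset.range (D + 1), C (a j) * X () ^ j with hQ
  have hQv : aeval (fun _ : Unit => v) Q = ∑ j ∈ Finset.range (D + 1), C (a j) * v ^ j := by
    simp only [hQ, map_sum, map_mul, aeval_C, map_pow, aeval_X, algebraMap_eq]
  have hLQ : complexity Q ≤ (D + 1) * (D + 2) := by
    refine (complexity_finset_sum_le _ _).trans ?_
    rw [Finset.card_range]
    have h1 : ∑ j ∈ Finset.range (D + 1), complexity (C (a j) * X () ^ j : MvPolynomial Unit F) ≤
        ∑ _j ∈ Finset.range (D + 1), (D + 1) := by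
      refine Finset.sum_le_sum fun j hj => ?_
      have hj' := Finset.mem_range.mp hj
      have h2 := complexity_C_holds (k := F) (σ := Unit) (a j)
      have h3 := complexity_X_pow_le (F := F) (σ := Unit) () j
      have h4 := complexity_mul_le_holds (C (a j) : MvPolynomial Unit F) (X () ^ j)
      omega
    rw [Finset.sum_const, Finset.card_range, smul_eq_mul] at h1
    calc ∑ j ∈ Finset.range (D + 1), complexity (C (a j) * X () ^ j : MvPolynomial Unit F) + (D + 1)
        ≤ (D + 1) * (D + 1) + (D + 1) := Nat.add_le_add_right h1 _
      _ = (D + 1) * (D + 2) := by ring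
  rw [← hQv]
  calc complexity (aeval (fun _ : Unit => v) Q) ≤ complexity Q + ∑ _i : Unit, complexity v :=
        complexity_aeval_le Q _
    _ ≤ complexity v + (D + 1) * (D + 2) := by
        rw [Finset.sum_const, Finset.card_univ, Fintype.card_unit, one_smul]
        omega

end Costs

/-! ### The semantic induction: truncate and materialise at every node -/

section Induction

/-- Arithmetic of the `+` gate step. [folklore] -/
private theorem arith_add {W P M S : ℕ} (hM : 4 ≤ M) (hP : 1 ≤ P) (hS : S ≤ 2 * (W * P) + 2 * W + 1) :
    S ≤ (W + 1) * (P * M) := by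
  have hWP : W ≤ W * P := Nat.le_mul_of_pos_right W hP
  calc S ≤ 2 * (W * P) + 2 * W + 1 := hS
    _ ≤ 4 * (W * P) + 4 * P := by omega
    _ = (W + 1) * (P * 4) := by ring
    _ ≤ (W + 1) * (P * M) := Nat.mul_le_mul_left _ (Nat.mul_le_mul_left _ hM)

/-- Arithmetic of the `×⋏` gate step. [folklore] -/
private theorem arith_mulPow {W P M A D S : ℕ} (hA : D + 2 ≤ A) (hM : 16 * A ^ 2 ≤ M) (hP : 1 ≤ P)
    (hS : S ≤ A * (2 * (W * P) + W * (2 * A + 2)) + D + 2) : S ≤ (W + 1) * (P * M) := by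
  have hA1 : 1 ≤ A := by omega
  have hWP : W ≤ W * P := Nat.le_mul_of_pos_right W hP
  have hXY : W * P ≤ A * (W * P) := Nat.le_mul_of_pos_left _ hA1
  have hAW : A * W ≤ A * (W * P) := Nat.mul_le_mul_left _ hWP
  have hZ : 1 ≤ A * P := Nat.mul_pos hA1 hP
  have hinner : 2 * (W * P) + W * (2 * A + 2) + 1 ≤ 6 * (A * (W * P)) + A * P := by
    have e1 : W * (2 * A + 2) = 2 * (A * W) + 2 * W := by ring
    rw [e1]
    omega
  have hAAP : A ≤ A * (A * P) := Nat.le_mul_of_pos_right A hZ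
  calc S ≤ A * (2 * (W * P) + W * (2 * A + 2)) + D + 2 := hS
    _ ≤ A * (2 * (W * P) + W * (2 * A + 2) + 1) + A := by
        have e2 : A * (2 * (W * P) + W * (2 * A + 2) + 1) = A * (2 * (W * P) + W * (2 * A + 2)) + A := by
          ring
        rw [e2]; omega
    _ ≤ A * (6 * (A * (W * P)) + A * P) + A * (A * P) :=
        Nat.add_le_add (Nat.mul_le_mul_left _ hinner) hAAP
    _ = A ^ 2 * (P * (6 * W + 2)) := by ring
    _ ≤ A ^ 2 * (P * (16 * (W + 1))) :=
        Nat.mul_le_mul_left _ (Nat.mul_le_mul_left _ (by omega))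
    _ = (W + 1) * (P * (16 * A ^ 2)) := by ring
    _ ≤ (W + 1) * (P * M) := Nat.mul_le_mul_left _ (Nat.mul_le_mul_left _ hM)

variable {F : Type*} [Field F] {n : ℕ}

/-- A formula in which no variable occurs computes a constant.
[cite: SahaThankey2021, Def. 3 (p. 50:3)] -/
theorem eval_eq_C_of_forall_occur_eq_zero (φ : Formula F n) (h : ∀ i, φ.occur i = 0) :
    φ.eval = C (coeff 0 φ.eval) :=
  totalDegree_eq_zero_iff_eq_C.mp (Thm9.totalDegree_eval_eq_zero_of_isOccur_zero φ fun i => (h i).le)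

/-- A subformula in which some variable occurs contributes `≥ 1` to `Σ_i occur_i`.
[cite: SahaThankey2021, Def. 3 (p. 50:3)] -/
theorem one_le_sum_occur_of_exists (φ : Formula F n) (h : ∃ i, φ.occur i ≠ 0) :
    1 ≤ ∑ i, φ.occur i := by
  obtain ⟨i, hi⟩ := h
  exact (Nat.one_le_iff_ne_zero.mpr hi).trans
    (Finset.single_le_sum (f := fun i => φ.occur i) (fun _ _ => Nat.zero_le _) (Finset.mem_univ i))

/-- **The truncated-evaluation complexity bound** (no size hypothesis, any occurrence pattern): for a
formula `φ` with `b`-variate leaves, `L(T_D(φ.eval)) ≤ (Σ_i occur_i(φ) + 1) · (16 (D+2)^{b+4})^{depth φ}`.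
Every node is truncated to degree `≤ D` and materialised: a leaf costs `≤ 2(D+1)^{b+1}`; at a gate the
children in which no variable occurs are constants and fold into one scalar, the others (at most
`Σ_i occur_i` of them) are charged; a `×⋏` power of ANY exponent costs `O(D²)` by the binomial Taylor
form (`Trunc.trunc_pow_eq_trunc_taylor`) composed with sharing (`complexity_aeval_le`), and each
truncation costs a factor `(D+2)²` (`complexity_sum_homogeneousComponent_le`).
[cite: SahaThankey2021, Thm 9 (p. 50:5 L13–16), b-variate leaves; Def. 3 (p. 50:3)] -/
theorem complexity_trunc_eval_le (D b : ℕ) (φ : Formula F n) (hφ : φ.LeavesVariate b) :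
    complexity (∑ e ∈ Finset.range (D + 1), homogeneousComponent e φ.eval) ≤
      ((∑ i, φ.occur i) + 1) * (16 * (D + 2) ^ (b + 4)) ^ φ.depth := by
  classical
  have hMpos : 0 < 16 * (D + 2) ^ (b + 4) := Nat.mul_pos (by norm_num) (Nat.pow_pos (by omega))
  have hM4 : 4 ≤ 16 * (D + 2) ^ (b + 4) :=
    le_trans (by norm_num) (Nat.mul_le_mul_left 16 (Nat.one_le_pow _ _ (by omega)))
  have hM16 : 16 * ((D + 2) ^ 2) ^ 2 ≤ 16 * (D + 2) ^ (b + 4) :=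
    Nat.mul_le_mul_left 16 (by rw [← pow_mul]; exact Nat.pow_le_pow_right (by omega) (by omega))
  have hA : D + 2 ≤ (D + 2) ^ 2 := Nat.le_self_pow two_ne_zero _
  induction φ with
  | leaf p =>
      simp only [Formula.LeavesVariate] at hφ
      simp only [Formula.eval, Formula.depth]
      calc complexity (∑ e ∈ Finset.range (D + 1), homogeneousComponent e p)
          ≤ 2 * (D + 1) ^ (b + 1) := complexity_trunc_le_of_card_vars_le D b p hφ
        _ ≤ 16 * (D + 2) ^ (b + 4) := by
            calc 2 * (D + 1) ^ (b + 1) ≤ 16 * (D + 2) ^ (b + 1) :=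
                  Nat.mul_le_mul (by norm_num) (Nat.pow_le_pow_left (by omega) _)
              _ ≤ 16 * (D + 2) ^ (b + 4) :=
                  Nat.mul_le_mul_left _ (Nat.pow_le_pow_right (by omega) (by omega))
        _ = 1 * (16 * (D + 2) ^ (b + 4)) ^ 1 := by ring
        _ ≤ ((∑ i, (Formula.leaf p : Formula F n).occur i) + 1) * (16 * (D + 2) ^ (b + 4)) ^ 2 :=
            Nat.mul_le_mul (by omega) (Nat.pow_le_pow_right hMpos (by omega))
  | add k α g ih =>
      simp only [Formula.LeavesVariate] at hφ
      -- the children in which some variable occurs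
      set Hc : Finset (Fin k) := Finset.univ.filter (fun j => ∃ i, (g j).occur i ≠ 0) with hHc
      have hlight : ∀ j : Fin k, j ∉ Hc → (g j).eval = C (coeff 0 (g j).eval) := by
        intro j hj
        refine eval_eq_C_of_forall_occur_eq_zero _ fun i => ?_
        by_contra h
        exact hj (Finset.mem_filter.mpr ⟨Finset.mem_univ _, i, h⟩)
      -- the value: the charged part plus one constant
      set β : F := ∑ j ∈ Finset.univ.filter (fun j : Fin k => ¬ ∃ i, (g j).occur i ≠ 0),
        α j * coeff 0 (g j).eval with hβ
      have hsplit : (Formula.add k α g).eval = ∑ j ∈ Hc, α j • (g j).eval + C β := by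
        simp only [Formula.eval]
        rw [← Finset.sum_filter_add_sum_filter_not Finset.univ
          (fun j : Fin k => ∃ i, (g j).occur i ≠ 0)]
        congr 1
        rw [hβ, map_sum]
        refine Finset.sum_congr rfl fun j hj => ?_
        have hj' : j ∉ Hc := fun h => (Finset.mem_filter.mp hj).2 (Finset.mem_filter.mp h).2
        rw [hlight j hj', smul_eq_C_mul, ← map_mul, coeff_zero_C]
      have hT : ∑ e ∈ Finset.range (D + 1), homogeneousComponent e (Formula.add k α g).eval =
          ∑ j ∈ Hc, α j • ∑ e ∈ Finset.range (D + 1), homogeneousComponent e (g j).eval + C β := by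
        rw [hsplit, Trunc.trunc_add, Trunc.trunc_sum, Trunc.trunc_C]
        simp only [Trunc.trunc_smul]
      -- bookkeeping
      simp only [Formula.depth]
      rw [hT, pow_succ]
      set M := 16 * (D + 2) ^ (b + 4) with hM
      set P := M ^ (Finset.univ.sup fun j : Fin k => (g j).depth) with hP
      set W := ∑ i, (Formula.add k α g).occur i with hW
      have hP1 : 1 ≤ P := Nat.one_le_pow _ _ hMpos
      have hW1 : ∀ j ∈ Hc, 1 ≤ ∑ i, (g j).occur i := fun j hj =>
        one_le_sum_occur_of_exists _ (Finset.mem_filter.mp hj).2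
      have hchild : ∀ j ∈ Hc, complexity (∑ e ∈ Finset.range (D + 1),
          homogeneousComponent e (g j).eval) ≤ 2 * (∑ i, (g j).occur i) * P := by
        intro j hj
        have hdep : M ^ (g j).depth ≤ P := Nat.pow_le_pow_right hMpos
          (Finset.le_sup (f := fun j : Fin k => (g j).depth) (Finset.mem_univ j))
        calc _ ≤ ((∑ i, (g j).occur i) + 1) * M ^ (g j).depth := ih j (hφ j)
          _ ≤ (2 * ∑ i, (g j).occur i) * P := Nat.mul_le_mul (by have := hW1 j hj; omega) hdep
          _ = 2 * (∑ i, (g j).occur i) * P := by ring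
      have hWsum : ∑ j ∈ Hc, ∑ i, (g j).occur i ≤ W := by
        rw [hW, sum_occur_add]
        exact Finset.sum_le_sum_of_subset_of_nonneg (Finset.filter_subset _ _)
          fun _ _ _ => Nat.zero_le _
      have hHc : Hc.card ≤ ∑ j ∈ Hc, ∑ i, (g j).occur i := by
        rw [Finset.card_eq_sum_ones]
        exact Finset.sum_le_sum hW1
      -- the estimate
      refine arith_add hM4 hP1 ?_
      have hWP : (∑ j ∈ Hc, ∑ i, (g j).occur i) * P ≤ W * P := Nat.mul_le_mul_right _ hWsum
      calc complexity (∑ j ∈ Hc, α j • ∑ e ∈ Finset.range (D + 1),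
              homogeneousComponent e (g j).eval + C β)
          ≤ complexity (∑ j ∈ Hc, α j • ∑ e ∈ Finset.range (D + 1),
              homogeneousComponent e (g j).eval) + complexity (C β : MvPolynomial (Fin n) F) + 1 :=
            complexity_add_le_holds _ _
        _ ≤ (∑ j ∈ Hc, complexity (α j • ∑ e ∈ Finset.range (D + 1),
              homogeneousComponent e (g j).eval) + Hc.card) + 0 + 1 := by
            rw [complexity_C_holds]
            exact Nat.add_le_add_right (Nat.add_le_add_right (complexity_finset_sum_le _ _) _) _
        _ ≤ (∑ j ∈ Hc, (2 * (∑ i, (g j).occur i) * P + 1) + Hc.card) + 0 + 1 := by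
            gcongr with j hj
            exact (complexity_smul_le_holds _ _).trans (Nat.add_le_add_right (hchild j hj) 1)
        _ = 2 * ((∑ j ∈ Hc, ∑ i, (g j).occur i) * P) + 2 * Hc.card + 1 := by
            rw [Finset.sum_add_distrib, Finset.sum_const, smul_eq_mul, mul_one, ← Finset.sum_mul,
              ← Finset.mul_sum]
            ring
        _ ≤ 2 * (W * P) + 2 * W + 1 := by omega
  | mulPow k e g ih =>
      simp only [Formula.LeavesVariate] at hφ
      set Hc : Finset (Fin k) := Finset.univ.filter (fun j => ∃ i, (g j).occur i ≠ 0) with hHc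
      have hlight : ∀ j : Fin k, j ∉ Hc → (g j).eval = C (coeff 0 (g j).eval) := by
        intro j hj
        refine eval_eq_C_of_forall_occur_eq_zero _ fun i => ?_
        by_contra h
        exact hj (Finset.mem_filter.mpr ⟨Finset.mem_univ _, i, h⟩)
      set γ : F := ∏ j ∈ Finset.univ.filter (fun j : Fin k => ¬ ∃ i, (g j).occur i ≠ 0),
        coeff 0 (g j).eval ^ e j with hγ
      have hsplit : (Formula.mulPow k e g).eval = C γ * ∏ j ∈ Hc, (g j).eval ^ e j := by
        simp only [Formula.eval]
        rw [← Finset.prod_filter_mul_prod_filter_not Finset.univ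
          (fun j : Fin k => ∃ i, (g j).occur i ≠ 0), mul_comm]
        congr 1
        rw [hγ, map_prod]
        refine Finset.prod_congr rfl fun j hj => ?_
        have hj' : j ∉ Hc := fun h => (Finset.mem_filter.mp hj).2 (Finset.mem_filter.mp h).2
        rw [hlight j hj', ← C_pow, coeff_zero_C]
      -- truncate: constant out, factors truncated, powers in Taylor form, inner truncations removed
      have hT : ∑ i ∈ Finset.range (D + 1), homogeneousComponent i (Formula.mulPow k e g).eval =
          C γ * ∑ i ∈ Finset.range (D + 1), homogeneousComponent i (∏ j ∈ Hc,
            ∑ l ∈ Finset.range (D + 1),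
              C (((e j).choose l : F) *
                coeff 0 (∑ i ∈ Finset.range (D + 1), homogeneousComponent i (g j).eval) ^ (e j - l)) *
              ((∑ i ∈ Finset.range (D + 1), homogeneousComponent i (g j).eval) -
                C (coeff 0 (∑ i ∈ Finset.range (D + 1), homogeneousComponent i (g j).eval))) ^ l) := by
        have hfac : ∀ j ∈ Hc,
            ∑ i ∈ Finset.range (D + 1), homogeneousComponent i ((g j).eval ^ e j) =
            ∑ i ∈ Finset.range (D + 1), homogeneousComponent i (∑ l ∈ Finset.range (D + 1),
              C (((e j).choose l : F) *
                coeff 0 (∑ i ∈ Finset.range (D + 1), homogeneousComponent i (g j).eval) ^ (e j - l)) *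
              ((∑ i ∈ Finset.range (D + 1), homogeneousComponent i (g j).eval) -
                C (coeff 0 (∑ i ∈ Finset.range (D + 1), homogeneousComponent i (g j).eval))) ^ l) :=
          fun j _ => by rw [Trunc.trunc_pow, Trunc.trunc_pow_eq_trunc_taylor]
        rw [hsplit, Trunc.trunc_C_mul, Trunc.trunc_prod, Finset.prod_congr rfl hfac,
          ← Trunc.trunc_prod]
      -- bookkeeping
      simp only [Formula.depth]
      rw [hT, pow_succ]
      set M := 16 * (D + 2) ^ (b + 4) with hM
      set P := M ^ (Finset.univ.sup fun j : Fin k => (g j).depth) with hP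
      set W := ∑ i, (Formula.mulPow k e g).occur i with hW
      have hP1 : 1 ≤ P := Nat.one_le_pow _ _ hMpos
      have hW1 : ∀ j ∈ Hc, 1 ≤ ∑ i, (g j).occur i := fun j hj =>
        one_le_sum_occur_of_exists _ (Finset.mem_filter.mp hj).2
      have hchild : ∀ j ∈ Hc, complexity (∑ e ∈ Finset.range (D + 1),
          homogeneousComponent e (g j).eval) ≤ 2 * (∑ i, (g j).occur i) * P := by
        intro j hj
        have hdep : M ^ (g j).depth ≤ P := Nat.pow_le_pow_right hMpos
          (Finset.le_sup (f := fun j : Fin k => (g j).depth) (Finset.mem_univ j))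
        calc _ ≤ ((∑ i, (g j).occur i) + 1) * M ^ (g j).depth := ih j (hφ j)
          _ ≤ (2 * ∑ i, (g j).occur i) * P := Nat.mul_le_mul (by have := hW1 j hj; omega) hdep
          _ = 2 * (∑ i, (g j).occur i) * P := by ring
      have hWsum : ∑ j ∈ Hc, ∑ i, (g j).occur i ≤ W := by
        rw [hW, sum_occur_mulPow]
        exact Finset.sum_le_sum_of_subset_of_nonneg (Finset.filter_subset _ _)
          fun _ _ _ => Nat.zero_le _
      have hHc : Hc.card ≤ ∑ j ∈ Hc, ∑ i, (g j).occur i := by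
        rw [Finset.card_eq_sum_ones]
        exact Finset.sum_le_sum hW1
      -- cost of one Taylor factor
      have hS : ∀ j ∈ Hc, complexity (∑ l ∈ Finset.range (D + 1),
          C (((e j).choose l : F) *
            coeff 0 (∑ i ∈ Finset.range (D + 1), homogeneousComponent i (g j).eval) ^ (e j - l)) *
          ((∑ i ∈ Finset.range (D + 1), homogeneousComponent i (g j).eval) -
            C (coeff 0 (∑ i ∈ Finset.range (D + 1), homogeneousComponent i (g j).eval))) ^ l) ≤
          2 * (∑ i, (g j).occur i) * P + ((D + 1) * (D + 2) + 1) := by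
        intro j hj
        have h1 := complexity_sum_C_mul_pow_le D (fun l => ((e j).choose l : F) *
            coeff 0 (∑ i ∈ Finset.range (D + 1), homogeneousComponent i (g j).eval) ^ (e j - l))
          ((∑ i ∈ Finset.range (D + 1), homogeneousComponent i (g j).eval) -
            C (coeff 0 (∑ i ∈ Finset.range (D + 1), homogeneousComponent i (g j).eval)))
        have h2 : complexity ((∑ i ∈ Finset.range (D + 1), homogeneousComponent i (g j).eval) -
            C (coeff 0 (∑ i ∈ Finset.range (D + 1), homogeneousComponent i (g j).eval))) ≤
            complexity (∑ i ∈ Finset.range (D + 1), homogeneousComponent i (g j).eval) + 1 := by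
          rw [sub_eq_add_neg, ← map_neg]
          calc _ ≤ complexity (∑ i ∈ Finset.range (D + 1), homogeneousComponent i (g j).eval) +
                complexity (C (-coeff 0 (∑ i ∈ Finset.range (D + 1),
                  homogeneousComponent i (g j).eval)) : MvPolynomial (Fin n) F) + 1 :=
              complexity_add_le_holds _ _
            _ = _ := by rw [complexity_C_holds, add_zero]
        have h3 := hchild j hj
        omega
      -- the estimate
      refine arith_mulPow hA hM16 hP1 ?_
      have h12 : (D + 1) * (D + 2) + 2 ≤ 2 * (D + 2) ^ 2 + 2 := by nlinarith
      have hHcW : Hc.card ≤ W := hHc.trans hWsum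
      have hsum : ∑ j ∈ Hc, (2 * (∑ i, (g j).occur i) * P + ((D + 1) * (D + 2) + 1)) + Hc.card =
          2 * (∑ j ∈ Hc, ∑ i, (g j).occur i) * P + Hc.card * ((D + 1) * (D + 2) + 2) := by
        rw [Finset.sum_add_distrib, Finset.sum_const, smul_eq_mul, ← Finset.sum_mul,
          ← Finset.mul_sum]
        ring
      have hY : 2 * (∑ j ∈ Hc, ∑ i, (g j).occur i) * P + Hc.card * ((D + 1) * (D + 2) + 2) ≤
          2 * (W * P) + W * (2 * (D + 2) ^ 2 + 2) := by
        have e1 : 2 * (∑ j ∈ Hc, ∑ i, (g j).occur i) * P ≤ 2 * (W * P) := by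
          rw [mul_assoc]
          exact Nat.mul_le_mul_left 2 (Nat.mul_le_mul_right P hWsum)
        exact Nat.add_le_add e1 (Nat.mul_le_mul hHcW h12)
      have hprod := (complexity_finset_prod_le Hc fun j => ∑ l ∈ Finset.range (D + 1),
          C (((e j).choose l : F) *
            coeff 0 (∑ i ∈ Finset.range (D + 1), homogeneousComponent i (g j).eval) ^ (e j - l)) *
          ((∑ i ∈ Finset.range (D + 1), homogeneousComponent i (g j).eval) -
            C (coeff 0 (∑ i ∈ Finset.range (D + 1), homogeneousComponent i (g j).eval))) ^ l).trans
        (Nat.add_le_add_right (Finset.sum_le_sum hS) Hc.card)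
      rw [hsum] at hprod
      have htr := complexity_sum_homogeneousComponent_le (∏ j ∈ Hc, ∑ l ∈ Finset.range (D + 1),
          C (((e j).choose l : F) *
            coeff 0 (∑ i ∈ Finset.range (D + 1), homogeneousComponent i (g j).eval) ^ (e j - l)) *
          ((∑ i ∈ Finset.range (D + 1), homogeneousComponent i (g j).eval) -
            C (coeff 0 (∑ i ∈ Finset.range (D + 1), homogeneousComponent i (g j).eval))) ^ l) D
      have hmul := complexity_mul_le_holds (C γ : MvPolynomial (Fin n) F)
        (∑ i ∈ Finset.range (D + 1), homogeneousComponent i (∏ j ∈ Hc, ∑ l ∈ Finset.range (D + 1),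
          C (((e j).choose l : F) *
            coeff 0 (∑ i ∈ Finset.range (D + 1), homogeneousComponent i (g j).eval) ^ (e j - l)) *
          ((∑ i ∈ Finset.range (D + 1), homogeneousComponent i (g j).eval) -
            C (coeff 0 (∑ i ∈ Finset.range (D + 1), homogeneousComponent i (g j).eval))) ^ l))
      rw [complexity_C_holds, zero_add] at hmul
      have hA1 := Nat.mul_le_mul_left ((D + 2) ^ 2) (hprod.trans hY)
      omega

end Induction

/-! ### Thm 9, second bound (`b`-variate leaves): main row, size bound, assembly -/

namespace Thm9

variable {F : Type*} [Field F] {n : ℕ}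

/-- **Main row of the `b`-variate bound** (`k, s ≥ 1`, `Δ ≥ 2`): with `d' = min(D, s^Δ)` the
Heintz–Schnorr hitting set for `{g : deg g ≤ d', L(g) ≤ (nk+1)(16(d'+2)^{b+4})^Δ + n(2n+1)}` on a grid
of `2d'+1` field elements hits the orbit of the class — by `complexity_trunc_eval_le` at `D = d'`
(`f = T_{d'} f` since `deg f ≤ d'`), `Σ_i occur_i ≤ nk`, and the orbit cost.
[cite: SahaThankey2021, Thm 9 (p. 50:5 L13–16); HeintzSchnorr1980, Thm. 4.4] -/
theorem exists_hittingSet_main_bVariate {D Δ k s : ℕ} (b : ℕ) (hk : 1 ≤ k) (hΔ : 2 ≤ Δ) (hs : 1 ≤ s)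
    (hF : ringChar F = 0 ∨ (2 * k * s) ^ (Δ ^ 3 * (2 * k) ^ (2 * Δ * 2 ^ Δ)) < ringChar F) :
    ∃ H : Finset (Fin n → F),
      H.card ≤ 9376 * (n + min D (s ^ Δ) +
          ((n * k + 1) * (16 * (min D (s ^ Δ) + 2) ^ (b + 4)) ^ Δ + n * (2 * n + 1)) + 2) ^ 26 *
        (Nat.log 2 ((2 * min D (s ^ Δ) + 1) ^ n * (3 * min D (s ^ Δ) + 1) + 1) + 1) + 1 ∧
      HittingSets.IsHittingSetFor (↑H) (orb F {f : MvPolynomial (Fin n) F | f.totalDegree ≤ D ∧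
        ∃ φ : Formula F n, φ.depth ≤ Δ ∧ φ.IsOccur k ∧ φ.size ≤ s ∧ φ.LeavesVariate b ∧
          φ.eval = f}) := by
  set d' := min D (s ^ Δ) with hd'
  -- a grid of `2 d' + 1` field elements exists (as for the first bound)
  have hgrid : Infinite F ∨ 2 * d' + 1 ≤ Nat.card F := by
    refine (infinite_or_le_card_of_ringChar hF).imp_right fun h => le_trans ?_ h
    have h1 : d' ≤ s ^ Δ := min_le_right _ _
    have hR : 1 ≤ (2 * k) ^ (2 * Δ * 2 ^ Δ) := Nat.one_le_pow _ _ (by omega)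
    have hexp : Δ + 1 ≤ Δ ^ 3 * (2 * k) ^ (2 * Δ * 2 ^ Δ) := by
      have h3 : Δ + 1 ≤ Δ ^ 3 := by
        have : Δ ^ 3 = Δ * Δ * Δ := by ring
        nlinarith
      exact h3.trans (Nat.le_mul_of_pos_right _ hR)
    have hks : 0 < 2 * k * s := Nat.mul_pos (by omega) hs
    have h2 : 2 * s ^ Δ ≤ (2 * k * s) ^ (Δ ^ 3 * (2 * k) ^ (2 * Δ * 2 ^ Δ)) :=
      calc 2 * s ^ Δ ≤ 2 ^ (Δ + 1) * s ^ (Δ + 1) :=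
            Nat.mul_le_mul (by calc (2 : ℕ) = 2 ^ 1 := (pow_one 2).symm
                                _ ≤ 2 ^ (Δ + 1) := Nat.pow_le_pow_right two_pos (by omega))
              (Nat.pow_le_pow_right hs (Nat.le_succ Δ))
        _ = (2 * s) ^ (Δ + 1) := (mul_pow 2 s (Δ + 1)).symm
        _ ≤ (2 * k * s) ^ (Δ + 1) :=
            Nat.pow_le_pow_left (Nat.mul_le_mul_right s (by omega : 2 ≤ 2 * k)) _
        _ ≤ (2 * k * s) ^ (Δ ^ 3 * (2 * k) ^ (2 * Δ * 2 ^ Δ)) := Nat.pow_le_pow_right hks hexp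
    omega
  obtain ⟨S, hScard⟩ := MS2021.exists_finset_card_eq (K := F) (2 * d' + 1) hgrid
  obtain ⟨H, -, hHcard, hhit⟩ :=
    HittingSets.exists_hittingSet (F := F) n
      ((n * k + 1) * (16 * (d' + 2) ^ (b + 4)) ^ Δ + n * (2 * n + 1)) d' S hScard.ge
  refine ⟨H, by rw [hScard] at hHcard; exact hHcard, fun g hg hg0 => ?_⟩
  rw [mem_orb_iff] at hg
  obtain ⟨f, ⟨hfD, φ, hφΔ, hφk, hφs, hφb, hφf⟩, hgf⟩ := hg
  have hdegf : f.totalDegree ≤ d' := by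
    refine le_min hfD ?_
    rw [← hφf]
    refine (totalDegree_eval_le_size_pow_depth φ).trans ?_
    rcases Nat.eq_zero_or_pos φ.size with h0 | hpos
    · rw [h0, zero_pow (by have := one_le_depth φ; omega)]
      exact Nat.zero_le _
    · exact (Nat.pow_le_pow_left hφs _).trans (Nat.pow_le_pow_right hs hφΔ)
  refine hhit g ((totalDegree_le_of_mem_linOrbit hgf).trans hdegf) ?_ hg0
  refine (complexity_le_of_mem_linOrbit hgf).trans (Nat.add_le_add_right ?_ _)
  -- `L(f) = L(T_{d'} f) ≤ (Σ occur + 1) M^{depth} ≤ (nk + 1) M^Δ`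
  rw [← Trunc.trunc_eq_self_of_le hdegf, ← hφf]
  refine (complexity_trunc_eval_le d' b φ hφb).trans (Nat.mul_le_mul ?_
    (Nat.pow_le_pow_right (Nat.mul_pos (by norm_num) (Nat.pow_pos (by omega))) hφΔ))
  have hW : ∑ i, φ.occur i ≤ ∑ _i : Fin n, k := Finset.sum_le_sum fun i _ => hφk i
  rw [Finset.sum_const, Finset.card_univ, Fintype.card_fin, smul_eq_mul] at hW
  omega

/-- `Nat.log 2 (a ^ n * b + 1) ≤ n * a + b` (crude: `a ≤ 2^a`, `b ≤ 2^b`). [folklore] -/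
private theorem log2_pow_mul_succ_le' (a b n : ℕ) : Nat.log 2 (a ^ n * b + 1) ≤ n * a + b := by
  have ha : a ^ n ≤ 2 ^ (n * a) := by
    calc a ^ n ≤ (2 ^ a) ^ n := Nat.pow_le_pow_left Nat.lt_two_pow_self.le n
      _ = 2 ^ (n * a) := by rw [← pow_mul, mul_comm]
  have hY : a ^ n * b + 1 < 2 ^ (n * a + b + 1) := by
    have hb1 : b + 1 ≤ 2 ^ b := Nat.lt_two_pow_self
    have h1 : 1 ≤ 2 ^ (n * a) := Nat.one_le_two_pow
    calc a ^ n * b + 1 ≤ 2 ^ (n * a) * b + 2 ^ (n * a) * 1 :=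
          add_le_add (Nat.mul_le_mul_right _ ha) (by simpa using h1)
      _ = 2 ^ (n * a) * (b + 1) := by ring
      _ ≤ 2 ^ (n * a) * 2 ^ b := Nat.mul_le_mul_left _ hb1
      _ = 2 ^ (n * a + b) := by rw [pow_add]
      _ < 2 ^ (n * a + b + 1) := Nat.pow_lt_pow_right (by norm_num) (by omega)
  have := (Nat.log_lt_iff_lt_pow one_lt_two (by omega)).2 hY
  omega

/-- **Size bound, general core** (opaque parameters): for `y ≥ 2`, `n, d' ≤ y`, `L₀ ≤ y^K`, `K ≥ 1`:
`9376 (n + d' + L₀ + 2)²⁶ (log₂((2d'+1)ⁿ(3d'+1) + 1) + 1) + 1 ≤ y^{26K + 71} + 1`.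
[cite: SahaThankey2021, Thm 9 (p. 50:5), the budgets "(nRD)^{O(·)}"] -/
theorem size_bound_core_general {n d' y L₀ K : ℕ} (hy2 : 2 ≤ y) (hny : n ≤ y) (hd'y : d' ≤ y)
    (hL : L₀ ≤ y ^ K) (hK : 1 ≤ K) :
    9376 * (n + d' + L₀ + 2) ^ 26 * (Nat.log 2 ((2 * d' + 1) ^ n * (3 * d' + 1) + 1) + 1) + 1 ≤
      y ^ (26 * K + 71) + 1 := by
  have hypos : 0 < y := by omega
  have hyK : y ≤ y ^ K := Nat.le_self_pow (by omega) y
  -- base `≤ 4 y^K ≤ y^{K+2}`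
  have hbase : n + d' + L₀ + 2 ≤ y ^ (K + 2) := by
    have h4 : 4 ≤ y ^ 2 := by
      calc (4 : ℕ) = 2 ^ 2 := by norm_num
        _ ≤ y ^ 2 := Nat.pow_le_pow_left hy2 2
    calc n + d' + L₀ + 2 ≤ 4 * y ^ K := by omega
      _ ≤ y ^ 2 * y ^ K := Nat.mul_le_mul_right _ h4
      _ = y ^ (K + 2) := by rw [← pow_add, Nat.add_comm 2 K]
  have hpow : (n + d' + L₀ + 2) ^ 26 ≤ y ^ (26 * K + 52) := by
    have hexp : (K + 2) * 26 = 26 * K + 52 := by ring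
    calc (n + d' + L₀ + 2) ^ 26 ≤ (y ^ (K + 2)) ^ 26 := Nat.pow_le_pow_left hbase 26
      _ = y ^ (26 * K + 52) := by rw [← pow_mul, hexp]
  have h8 : 8 ≤ y ^ 3 := by
    calc (8 : ℕ) = 2 ^ 3 := by norm_num
      _ ≤ y ^ 3 := Nat.pow_le_pow_left hy2 3
  have hlog : Nat.log 2 ((2 * d' + 1) ^ n * (3 * d' + 1) + 1) + 1 ≤ y ^ 5 := by
    have h0 := log2_pow_mul_succ_le' (2 * d' + 1) (3 * d' + 1) n
    have h1 : n * (2 * d' + 1) + (3 * d' + 1) + 1 ≤ 6 * y ^ 2 := by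
      have e1 : n * (2 * d' + 1) ≤ y * (2 * y + 1) := Nat.mul_le_mul hny (by omega)
      have e2 : y * (2 * y + 1) = 2 * y ^ 2 + y := by ring
      have e3 : 2 * y ≤ y ^ 2 := by
        calc 2 * y ≤ y * y := Nat.mul_le_mul_right y hy2
          _ = y ^ 2 := (pow_two y).symm
      omega
    have h6 : 6 ≤ y ^ 3 := le_trans (by norm_num) h8
    calc Nat.log 2 ((2 * d' + 1) ^ n * (3 * d' + 1) + 1) + 1 ≤ 6 * y ^ 2 := by omega
      _ ≤ y ^ 3 * y ^ 2 := Nat.mul_le_mul_right _ h6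
      _ = y ^ 5 := by rw [← pow_add]
  have h9376 : 9376 ≤ y ^ 14 := by
    calc (9376 : ℕ) ≤ 2 ^ 14 := by norm_num
      _ ≤ y ^ 14 := Nat.pow_le_pow_left hy2 14
  have hexp2 : 14 + (26 * K + 52) + 5 = 26 * K + 71 := by ring
  calc 9376 * (n + d' + L₀ + 2) ^ 26 * (Nat.log 2 ((2 * d' + 1) ^ n * (3 * d' + 1) + 1) + 1) + 1
      ≤ y ^ 14 * y ^ (26 * K + 52) * y ^ 5 + 1 :=
        Nat.add_le_add_right (Nat.mul_le_mul (Nat.mul_le_mul h9376 hpow) hlog) 1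
    _ = y ^ (26 * K + 71) + 1 := by rw [← pow_add, ← pow_add, hexp2]

/-- **Size bound for the `b`-variate main row**: with `R = (2k)^{2Δ·2^Δ}` (so `R ≥ 16`, `R ≥ Δ`,
`R ≥ k`), `y = nRD`: `(nk+1)(16(d'+2)^{b+4})^Δ + n(2n+1) ≤ y^{(b+5)Δ+3}`, hence the Heintz–Schnorr
count is `≤ y^{26(b+5)Δ + 149} + 1 ≤ y^{150(Rb + ΔR + 1)} + 150`.
[cite: SahaThankey2021, Thm 9 (p. 50:5 L13–16), "(nRD)^{O(Rb + ΔR)}"] -/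
theorem size_bound_bVariate {n D Δ k b d' : ℕ} (hn : 1 ≤ n) (hD : 1 ≤ D) (hk : 1 ≤ k)
    (hΔ : 2 ≤ Δ) (hd' : d' ≤ D) :
    9376 * (n + d' + ((n * k + 1) * (16 * (d' + 2) ^ (b + 4)) ^ Δ + n * (2 * n + 1)) + 2) ^ 26 *
        (Nat.log 2 ((2 * d' + 1) ^ n * (3 * d' + 1) + 1) + 1) + 1 ≤
      (n * (2 * k) ^ (2 * Δ * 2 ^ Δ) * D) ^
        (150 * ((2 * k) ^ (2 * Δ * 2 ^ Δ) * b + Δ * (2 * k) ^ (2 * Δ * 2 ^ Δ) + 1)) + 150 := by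
  -- facts about `R`
  have hexp1 : 1 ≤ 2 * Δ * 2 ^ Δ := by
    have := Nat.one_le_two_pow (n := Δ)
    calc 1 ≤ 2 ^ Δ := this
      _ = 1 * 2 ^ Δ := (one_mul _).symm
      _ ≤ 2 * Δ * 2 ^ Δ := Nat.mul_le_mul_right _ (by omega)
  have hR16 : 16 ≤ (2 * k) ^ (2 * Δ * 2 ^ Δ) := by
    have h4 : 4 ≤ 2 * Δ * 2 ^ Δ := by
      have := Nat.one_le_two_pow (n := Δ)
      calc 4 ≤ 2 * Δ := by omega
        _ = 2 * Δ * 1 := (mul_one _).symm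
        _ ≤ 2 * Δ * 2 ^ Δ := Nat.mul_le_mul_left _ this
    calc (16 : ℕ) = 2 ^ 4 := by norm_num
      _ ≤ 2 ^ (2 * Δ * 2 ^ Δ) := Nat.pow_le_pow_right two_pos h4
      _ ≤ (2 * k) ^ (2 * Δ * 2 ^ Δ) := Nat.pow_le_pow_left (by omega) _
  have hRΔ : Δ ≤ (2 * k) ^ (2 * Δ * 2 ^ Δ) := by
    calc Δ ≤ 2 ^ Δ := Nat.lt_two_pow_self.le
      _ ≤ (2 * k) ^ Δ := Nat.pow_le_pow_left (by omega) _
      _ ≤ (2 * k) ^ (2 * Δ * 2 ^ Δ) := Nat.pow_le_pow_right (by omega)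
          (by have := Nat.one_le_two_pow (n := Δ); nlinarith)
  have hRk : k ≤ (2 * k) ^ (2 * Δ * 2 ^ Δ) := by
    calc k ≤ 2 * k := by omega
      _ = (2 * k) ^ 1 := (pow_one _).symm
      _ ≤ (2 * k) ^ (2 * Δ * 2 ^ Δ) := Nat.pow_le_pow_right (by omega) hexp1
  generalize (2 * k) ^ (2 * Δ * 2 ^ Δ) = R at hR16 hRΔ hRk ⊢
  -- facts about `y = n R D`
  have hy16 : 16 ≤ n * R * D := by
    calc 16 ≤ R := hR16
      _ = 1 * R * 1 := by ring
      _ ≤ n * R * D := Nat.mul_le_mul (Nat.mul_le_mul hn le_rfl) hD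
  have hny : n ≤ n * R * D := by
    calc n = n * 1 * 1 := by ring
      _ ≤ n * R * D := Nat.mul_le_mul (Nat.mul_le_mul le_rfl (by omega)) hD
  have hDy : D + 2 ≤ n * R * D := by
    calc D + 2 ≤ 16 * D := by omega
      _ = 1 * 16 * D := by ring
      _ ≤ n * R * D := Nat.mul_le_mul (Nat.mul_le_mul hn hR16) le_rfl
  have hnky : n * k ≤ n * R * D := by
    calc n * k = n * k * 1 := (mul_one _).symm
      _ ≤ n * R * D := Nat.mul_le_mul (Nat.mul_le_mul_left n hRk) hD
  generalize n * R * D = y at hy16 hny hDy hnky ⊢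
  have hypos : 0 < y := by omega
  -- `L₀ ≤ y^{(b+5)Δ+3}`
  have hM : 16 * (d' + 2) ^ (b + 4) ≤ y ^ (b + 5) := by
    calc 16 * (d' + 2) ^ (b + 4) ≤ y * y ^ (b + 4) :=
          Nat.mul_le_mul (by omega) (Nat.pow_le_pow_left (by omega) _)
      _ = y ^ (b + 5) := by rw [← pow_succ']
  have hL : (n * k + 1) * (16 * (d' + 2) ^ (b + 4)) ^ Δ + n * (2 * n + 1) ≤ y ^ ((b + 5) * Δ + 3) := by
    have e1 : (16 * (d' + 2) ^ (b + 4)) ^ Δ ≤ y ^ ((b + 5) * Δ) := by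
      rw [pow_mul]; exact Nat.pow_le_pow_left hM _
    have e2 : n * k + 1 ≤ y ^ 2 := by
      calc n * k + 1 ≤ y + y := by omega
        _ = 2 * y := (two_mul y).symm
        _ ≤ y * y := Nat.mul_le_mul_right y (by omega)
        _ = y ^ 2 := (pow_two y).symm
    have e3 : n * (2 * n + 1) ≤ 3 * y ^ 2 := by
      have f1 : n * (2 * n + 1) ≤ y * (2 * y + 1) := Nat.mul_le_mul hny (by omega)
      have f2 : y * (2 * y + 1) = 2 * y ^ 2 + y := by ring
      have f3 : y ≤ y ^ 2 := Nat.le_self_pow two_ne_zero y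
      omega
    have e4 : y ^ 2 ≤ y ^ 2 * y ^ ((b + 5) * Δ) :=
      Nat.le_mul_of_pos_right _ (Nat.pow_pos hypos)
    calc (n * k + 1) * (16 * (d' + 2) ^ (b + 4)) ^ Δ + n * (2 * n + 1)
        ≤ y ^ 2 * y ^ ((b + 5) * Δ) + 3 * y ^ 2 := Nat.add_le_add (Nat.mul_le_mul e2 e1) e3
      _ ≤ 4 * (y ^ 2 * y ^ ((b + 5) * Δ)) := by omega
      _ ≤ y * (y ^ 2 * y ^ ((b + 5) * Δ)) := Nat.mul_le_mul_right _ (by omega)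
      _ = y ^ ((b + 5) * Δ + 3) := by ring
  have hcore := size_bound_core_general (n := n) (d' := d') (le_trans (by norm_num) hy16) hny ((hd'.trans (by omega)))
    hL (by nlinarith)
  refine hcore.trans (Nat.add_le_add (Nat.pow_le_pow_right hypos ?_) (by norm_num))
  -- exponent budget `26((b+5)Δ+3) + 71 ≤ 150 (R b + Δ R + 1)`
  have h1 : b * Δ ≤ R * b := by rw [mul_comm R]; exact Nat.mul_le_mul_left b hRΔ
  have h2 : Δ ≤ Δ * R := Nat.le_mul_of_pos_right Δ (by omega)
  have e : 26 * ((b + 5) * Δ + 3) + 71 = 26 * (b * Δ) + 130 * Δ + 149 := by ring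
  rw [e]
  omega

end Thm9

/-- **Saha–Thankey 2021, Thm 9, second bound (`b`-variate leaves; existence reading), PROVED**
with `c = 150`: under the printed characteristic hypothesis, for every `b` there is a hitting set
for the orbit of the degree-`≤ D` polynomials computed by depth-`≤ Δ` occur-`k` size-`≤ s` formulas
WITH `b`-VARIATE LEAVES of size `≤ (nRD)^{c(Rb + ΔR + 1)} + c`, `R = (2k)^{2Δ·2^Δ}` — a bound free of
`s`, verbatim the second conjunct of `sahaThankey2021_thm_9`. Route ≠ print (disclosed): degree
truncation at every node (`complexity_trunc_eval_le`) + Heintz–Schnorr existence; the characteristic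
hypothesis is used only to have `≥ 2·min(D, s^Δ) + 1` field elements.
[cite: SahaThankey2021, Thm 9 (p. 50:5 L13–16); HeintzSchnorr1980, Thm. 4.4] -/
theorem thm_9_bVariate_bound : ∃ c : ℕ, ∀ (F : Type) [Field F] (n D Δ k s : ℕ),
    (ringChar F = 0 ∨ (2 * k * s) ^ (Δ ^ 3 * (2 * k) ^ (2 * Δ * 2 ^ Δ)) < ringChar F) →
    ∀ b : ℕ, ∃ H : Finset (Fin n → F),
      H.card ≤ (n * (2 * k) ^ (2 * Δ * 2 ^ Δ) * D) ^
        (c * ((2 * k) ^ (2 * Δ * 2 ^ Δ) * b + Δ * (2 * k) ^ (2 * Δ * 2 ^ Δ) + 1)) + c ∧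
      HittingSets.IsHittingSetFor (↑H) (orb F {f : MvPolynomial (Fin n) F | f.totalDegree ≤ D ∧
        ∃ φ : Formula F n, φ.depth ≤ Δ ∧ φ.IsOccur k ∧ φ.size ≤ s ∧ φ.LeavesVariate b ∧
          φ.eval = f}) := by
  refine ⟨150, fun F _ n D Δ k s hF b => ?_⟩
  by_cases hmain : 1 ≤ n ∧ 1 ≤ D ∧ 1 ≤ k ∧ 2 ≤ Δ ∧ 1 ≤ s
  · obtain ⟨hn, hD, hk, hΔ, hs⟩ := hmain
    obtain ⟨H, hcard, hhit⟩ :=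
      Thm9.exists_hittingSet_main_bVariate (F := F) (n := n) (D := D) b hk hΔ hs hF
    exact ⟨H, hcard.trans (Thm9.size_bound_bVariate hn hD hk hΔ (min_le_left _ _)), hhit⟩
  · -- degenerate rows: constants, hit by the point `0`
    refine ⟨{fun _ => 0}, ?_, Thm9.isHittingSetFor_zero_orb_of_totalDegree_eq_zero ?_⟩
    · rw [Finset.card_singleton]
      omega
    · rintro f ⟨hfD, φ, hφΔ, hφk, hφs, -, rfl⟩
      simp only [not_and_or, not_le] at hmain
      rcases hmain with h | h | h | h | h
      · -- no variables: every monomial is trivial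
        obtain rfl : n = 0 := by omega
        classical
        apply Nat.eq_zero_of_le_zero
        rw [totalDegree]
        refine Finset.sup_le fun m _ => ?_
        rw [show m = 0 from Finsupp.ext fun i => i.elim0]
        simp
      · obtain rfl : D = 0 := by omega
        exact Nat.eq_zero_of_le_zero hfD
      · obtain rfl : k = 0 := by omega
        exact Thm9.totalDegree_eval_eq_zero_of_isOccur_zero φ hφk
      · exact Thm9.totalDegree_eval_eq_zero_of_depth_le_one φ (by omega)
      · obtain rfl : s = 0 := by omega
        exact Thm9.totalDegree_eval_eq_zero_of_size_eq_zero φ (Nat.eq_zero_of_le_zero hφs)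

end SahaThankey2021

/-- **Saha–Thankey 2021, Thm 9 (`sahaThankey2021_thm_9`) DISCHARGED BY NAME**: the first conjunct
is `SahaThankey2021.thm_9_general_bound` (`ST21ConstantDepthOrbitHittingSetProofs.lean`), the second
is `SahaThankey2021.thm_9_bVariate_bound` (this file, by degree truncation), merged by the edge
`SahaThankey2021.sahaThankey2021_thm_9_of_bVariate_bound`. Existence reading as typed (explicitness
dropped by the typing); routes ≠ the printed explicit constructions, disclosed in both files.
[cite: SahaThankey2021, Thm 9 (p. 50:5 L9–16); HeintzSchnorr1980, Thm. 4.4] -/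
theorem sahaThankey2021_thm_9_holds : sahaThankey2021_thm_9 :=
  SahaThankey2021.sahaThankey2021_thm_9_of_bVariate_bound SahaThankey2021.thm_9_bVariate_bound

end Literature.Computability.AlgebraicComplexity

end
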